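import Summits.NavierStokesRegularity.NavierStokesRegularity.Theorems.RellichScarScarRigidityPaintedLadderDefect
import Summits.NavierStokesRegularity.NavierStokesRegularity.Theorems.RellichScarScarRigidityCoulombPoisson
import Summits.NavierStokesRegularity.NavierStokesRegularity.Theorems.RellichScarScarRigidityCoulombBounds
import Literature.Analysis.FluidPDE.HarmonicVanishing
import HarnessLib

/-!
# `ScarRigidity`, line `moment-conditioned-rellich` — stub `stub_paintedLadderHigher` (PL≥2), part 3:
# the representation `Dᵇ(Q₁ − Q₂) = −Γ ⋆ Dᵇg` of all derivatives of the pressure difference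

Crux stmt-NavierStokesRegularity-11717 (route RellichScar), helper file (`--supports`) for the registered stub
`stub_paintedLadderHigher`.  On a slice `t < 0` the pressure difference `π = Q₁ − Q₂` of two classical pairs in the
decaying gauges solves `Δπ = −g` (part 2) and decays with all derivatives, and the source `g` decays like `ρ^{−(N+5+b)}`
with all derivatives.  Hence EVERY COMPONENT OF EVERY DERIVATIVE of `π` is the Newtonian potential of the corresponding
component of the derivative of the source:

  `Dᵇπ(t,x)(m) = −∫ Γ(x − y) Dᵇg(t,y)(m) dy`   (`iteratedFDeriv_pressureDiff_apply_eq`, `Γ = newtonKernel = −1/(4π|z|)`),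

because both sides are `C²`, decay at infinity, and have the same Laplacian `−Dᵇg(·)(m)` — the difference is an entire
harmonic function vanishing at infinity (`harmonic_eq_zero_of_tendsto_cocompact`).  No derivative ever falls on the
kernel.  Ingredients proved here:

* `iteratedFDeriv_fderiv_apply_comm` — **partial derivatives commute with `Dⁿ`** for smooth maps:
  `Dⁿ(∂ᵥφ)(x) = ∂ᵥ(Dⁿφ)(x)` (the tree's time/space exchange `hasDerivAt_iteratedFDeriv_slice` applied to the artificial
  time `s ↦ φ(· + s v)`); hence `Dᵏ(Dⁿφ)(x)(u) = Dⁿ(Dᵏφ(·)(u))(x)` and **`Δ(Dⁿφ) = Dⁿ(Δφ)`** (`laplacian_iteratedFDeriv`);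
* `newtonPotential_scalar` — the Newtonian potential of a scalar `C²` apex density `|h| ≤ A/(‖y‖+a)³` is `C²`, solves
  `Δu = h` and tends to `0` at infinity (lead 0's vector-valued Coulomb toolkit on `h e₀`).
-/

noncomputable section

open Set Filter Function MeasureTheory Metric TopologicalSpace
open scoped Topology ContDiff Laplacian InnerProductSpace RealInnerProductSpace
open Literature.Analysis.FluidPDE InnerProductSpace

set_option linter.dupNamespace false -- D-0017: `Summit.<S>.<S>.…` repeats the summit name by design

-- nested operator types
set_option maxSynthPendingDepth 4

namespace Summit.NavierStokesRegularity.NavierStokesRegularity.Theorems.RellichScarScarRigidity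

/-! ### Partial derivatives commute with iterated derivatives -/

section Commute

variable {X : Type*} [NormedAddCommGroup X] [NormedSpace ℝ X]
variable {F : Type*} [NormedAddCommGroup F] [NormedSpace ℝ F]

/-- **`Dⁿ(∂ᵥφ)(x) = ∂ᵥ(Dⁿφ)(x)`** for a smooth map `φ` and a fixed direction `v`: the field `(s, y) ↦ φ(y + s v)` is
jointly smooth, its slices are translates of `φ` (so `Dⁿ` of the slice at `x` is `Dⁿφ(x + s v)`), and the tree's exchange
of `∂ₛ` with `Dⁿ` at `s = 0` is the claim. [folklore] -/
theorem iteratedFDeriv_fderiv_apply_comm {φ : X → F} (hφ : ContDiff ℝ ∞ φ) (v : X) (n : ℕ) (x : X) :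
    iteratedFDeriv ℝ n (fun y => fderiv ℝ φ y v) x = fderiv ℝ (iteratedFDeriv ℝ n φ) x v := by
  set w : ℝ → X → F := fun s y => φ (y + s • v) with hw_def
  have hw : IsSmoothSpaceTimeOn univ w := by
    have h1 : ContDiff ℝ ∞ (uncurry w) :=
      hφ.comp (contDiff_snd.add (contDiff_fst.smul contDiff_const))
    exact h1.contDiffOn
  have h := hasDerivAt_iteratedFDeriv_slice hw isOpen_univ n 0 (mem_univ _) x
  have e1 : (fun y => deriv (fun s => w s y) 0) = fun y => fderiv ℝ φ y v := by
    funext y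
    have hl : HasDerivAt (fun s : ℝ => y + s • v) v 0 := by
      simpa using ((hasDerivAt_id (0 : ℝ)).smul_const v).const_add y
    have hd : DifferentiableAt ℝ φ (y + (0 : ℝ) • v) := hφ.differentiable (by simp) _
    have h2 := hd.hasFDerivAt.comp_hasDerivAt (0 : ℝ) hl
    rw [zero_smul, add_zero] at h2
    exact h2.deriv
  have e2 : (fun s => iteratedFDeriv ℝ n (w s) x) = fun s => iteratedFDeriv ℝ n φ (x + s • v) := by
    funext s
    exact iteratedFDeriv_comp_add_right n (s • v) x
  rw [e1, e2] at h
  have hn : ((n : ℕ∞) : WithTop ℕ∞) < ∞ := by exact_mod_cast ENat.coe_lt_top n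
  have hD : Differentiable ℝ (iteratedFDeriv ℝ n φ) := hφ.differentiable_iteratedFDeriv hn
  have hl : HasDerivAt (fun s : ℝ => x + s • v) v 0 := by
    simpa using ((hasDerivAt_id (0 : ℝ)).smul_const v).const_add x
  have h2 := (hD (x + (0 : ℝ) • v)).hasFDerivAt.comp_hasDerivAt (0 : ℝ) hl
  rw [zero_smul, add_zero] at h2
  exact h.unique h2

/-- **`Dᵏ(Dⁿφ)(x)(u) = Dⁿ(Dᵏφ(·)(u))(x)`** for smooth `φ` and fixed directions `u` (induction on `k` from
`iteratedFDeriv_fderiv_apply_comm`). [folklore] -/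
theorem iteratedFDeriv_iteratedFDeriv_apply_comm {φ : X → F} (hφ : ContDiff ℝ ∞ φ) (n : ℕ) :
    ∀ (k : ℕ) (u : Fin k → X) (x : X),
      iteratedFDeriv ℝ k (iteratedFDeriv ℝ n φ) x u = iteratedFDeriv ℝ n (fun y => iteratedFDeriv ℝ k φ y u) x := by
  intro k
  induction k with
  | zero =>
    intro u x
    simp only [iteratedFDeriv_zero_apply]
  | succ k ih =>
    intro u x
    have hφk : ContDiff ℝ ∞ (fun y => iteratedFDeriv ℝ k φ y (Fin.tail u)) :=
      (ContinuousMultilinearMap.apply ℝ (fun _ : Fin k => X) F (Fin.tail u)).contDiff.comp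
        (hφ.iteratedFDeriv_right (m := ∞) le_rfl)
    have hDn : ContDiff ℝ ∞ (iteratedFDeriv ℝ n φ) := hφ.iteratedFDeriv_right (m := ∞) le_rfl
    have hk : ((k : ℕ∞) : WithTop ℕ∞) < ∞ := by exact_mod_cast ENat.coe_lt_top k
    have hDk : Differentiable ℝ (iteratedFDeriv ℝ k (iteratedFDeriv ℝ n φ)) := hDn.differentiable_iteratedFDeriv hk
    have hDkφ : Differentiable ℝ (iteratedFDeriv ℝ k φ) := hφ.differentiable_iteratedFDeriv hk
    rw [iteratedFDeriv_succ_apply_left, ← fderiv_continuousMultilinear_apply_const_apply (hDk x)]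
    have e1 : (fun y => iteratedFDeriv ℝ k (iteratedFDeriv ℝ n φ) y (Fin.tail u)) =
        fun y => iteratedFDeriv ℝ n (fun z => iteratedFDeriv ℝ k φ z (Fin.tail u)) y := funext fun y => ih _ y
    rw [e1, ← iteratedFDeriv_fderiv_apply_comm hφk (u 0) n x]
    congr 1
    funext y
    rw [iteratedFDeriv_succ_apply_left, fderiv_continuousMultilinear_apply_const_apply (hDkφ y)]

end Commute

/-- **`Δ(Dⁿφ)(x) = Dⁿ(Δφ)(x)`** for smooth `φ` on `ℝ³` (the Laplacian is the trace of the Hessian over the standard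
basis, and `D²(Dⁿφ)(x)(eᵢ,eᵢ) = Dⁿ(D²φ(·)(eᵢ,eᵢ))(x)`). [folklore] -/
theorem laplacian_iteratedFDeriv {F : Type*} [NormedAddCommGroup F] [NormedSpace ℝ F]
    {φ : EuclideanSpace ℝ (Fin 3) → F} (hφ : ContDiff ℝ ∞ φ) (n : ℕ) (x : EuclideanSpace ℝ (Fin 3)) :
    Δ (iteratedFDeriv ℝ n φ) x = iteratedFDeriv ℝ n (Δ φ) x := by
  set b := stdOrthonormalBasis ℝ (EuclideanSpace ℝ (Fin 3)) with hb
  rw [laplacian_eq_iteratedFDeriv_orthonormalBasis (iteratedFDeriv ℝ n φ) b,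
    laplacian_eq_iteratedFDeriv_orthonormalBasis φ b]
  have hn : ((n : ℕ∞) : WithTop ℕ∞) ≤ ∞ := by exact_mod_cast le_top
  have hsm : ∀ i, ContDiff ℝ n (fun y => iteratedFDeriv ℝ 2 φ y ![b i, b i]) := fun i =>
    (ContinuousMultilinearMap.apply ℝ (fun _ : Fin 2 => EuclideanSpace ℝ (Fin 3)) F ![b i, b i]).contDiff.comp
      ((hφ.iteratedFDeriv_right (m := ∞) le_rfl).of_le hn)
  change ∑ i, iteratedFDeriv ℝ 2 (iteratedFDeriv ℝ n φ) x ![b i, b i] =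
    iteratedFDeriv ℝ n (fun y => ∑ i, iteratedFDeriv ℝ 2 φ y ![b i, b i]) x
  rw [iteratedFDeriv_fun_sum_apply fun i _ => (hsm i).contDiffAt]
  exact Finset.sum_congr rfl fun i _ => iteratedFDeriv_iteratedFDeriv_apply_comm hφ n 2 _ x

/-! ### The Newtonian potential of a scalar apex density -/

/-- **The Newtonian potential of a scalar `C²` apex density** `|h(y)| ≤ A/(‖y‖+a)³` (`a > 0`):
`u(x) = ∫ Γ(x − y) h(y) dy` is `C²`, solves `Δu = h`, and `u(x) → 0` as `‖x‖ → ∞` (the vector-valued toolkit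
`contDiff_two_newtonPotential`, `laplacian_newtonPotential`, `exists_integral_norm_newtonKernel_smul_le` applied to
`h e₀`; `|u(x)| ≤ K A a^{−1/4}‖x‖^{−3/4}`). [cite: GilbargTrudinger2001, (2.17)] -/
theorem newtonPotential_scalar {h : EuclideanSpace ℝ (Fin 3) → ℝ} (hh : ContDiff ℝ 2 h) {A a : ℝ} (ha : 0 < a)
    (hA : 0 ≤ A) (hb : ∀ y, |h y| ≤ A * ((‖y‖ + a) ^ 3)⁻¹) :
    ContDiff ℝ 2 (fun x => ∫ y, newtonKernel (x - y) * h y) ∧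
      (∀ x, Δ (fun x => ∫ y, newtonKernel (x - y) * h y) x = h x) ∧
        Tendsto (fun x => ∫ y, newtonKernel (x - y) * h y) (cocompact (EuclideanSpace ℝ (Fin 3))) (𝓝 0) := by
  set e₀ : EuclideanSpace ℝ (Fin 3) := EuclideanSpace.single (0 : Fin 3) (1 : ℝ) with he₀
  have he₀n : ‖e₀‖ = 1 := by simp [he₀]
  set w : EuclideanSpace ℝ (Fin 3) → EuclideanSpace ℝ (Fin 3) := fun y => h y • e₀ with hw_def
  have hw : ContDiff ℝ 2 w := hh.smul contDiff_const
  have hwb : ∀ y, ‖w y‖ ≤ A * ((‖y‖ + a) ^ 3)⁻¹ := fun y => by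
    rw [hw_def, norm_smul, he₀n, mul_one, Real.norm_eq_abs]; exact hb y
  set U : EuclideanSpace ℝ (Fin 3) → EuclideanSpace ℝ (Fin 3) := fun x => ∫ y, newtonKernel (x - y) • w y with hU_def
  have eU : U = fun x => (∫ y, newtonKernel (x - y) * h y) • e₀ := by
    funext x
    simp only [hU_def, hw_def, smul_smul]
    exact integral_smul_const _ e₀
  set L : EuclideanSpace ℝ (Fin 3) →L[ℝ] ℝ := EuclideanSpace.proj (0 : Fin 3) with hL
  have eu : (fun x => ∫ y, newtonKernel (x - y) * h y) = L ∘ U := by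
    funext x
    rw [comp_apply, eU]
    simp [hL, he₀]
  have hU2 : ContDiff ℝ 2 U := contDiff_two_newtonPotential hw ha hA hwb
  have hΔU : ∀ x, Δ U x = w x := laplacian_newtonPotential hw ha hA hwb
  refine ⟨?_, fun x => ?_, ?_⟩
  · rw [eu]; exact L.contDiff.comp hU2
  · rw [eu, ContDiffAt.laplacian_CLM_comp_left hU2.contDiffAt, comp_apply, hΔU x]
    simp [hL, hw_def, he₀]
  · -- decay: `|u(x)| ≤ ‖U x‖ ≤ ∫ ‖Γ(x-y) • w y‖ ≤ K A a^{-1/4} ‖x‖^{-3/4}`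
    obtain ⟨K, hK0, hK⟩ := exists_integral_norm_newtonKernel_smul_le
    have hbound : ∀ x : EuclideanSpace ℝ (Fin 3), x ≠ 0 →
        ‖∫ y, newtonKernel (x - y) * h y‖ ≤ K * A * a ^ (-(1 / 4 : ℝ)) * ‖x‖ ^ (-(3 / 4 : ℝ)) := by
      intro x hx
      have h1 : ‖∫ y, newtonKernel (x - y) * h y‖ = ‖U x‖ := by
        rw [eU]; simp only [norm_smul, he₀n, mul_one]
      rw [h1]
      exact (norm_integral_le_integral_norm _).trans (hK a A ha hA w hwb x hx)
    rw [tendsto_zero_iff_norm_tendsto_zero]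
    have hlim : Tendsto (fun x : EuclideanSpace ℝ (Fin 3) => K * A * a ^ (-(1 / 4 : ℝ)) * ‖x‖ ^ (-(3 / 4 : ℝ)))
        (cocompact (EuclideanSpace ℝ (Fin 3))) (𝓝 0) := by
      have h1 := (tendsto_rpow_neg_atTop (by norm_num : (0 : ℝ) < 3 / 4)).comp
        (tendsto_norm_cocompact_atTop (E := EuclideanSpace ℝ (Fin 3)))
      have h2 := h1.const_mul (K * A * a ^ (-(1 / 4 : ℝ)))
      rw [mul_zero] at h2
      exact h2
    have hev : ∀ᶠ x in cocompact (EuclideanSpace ℝ (Fin 3)), ‖∫ y, newtonKernel (x - y) * h y‖ ≤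
        K * A * a ^ (-(1 / 4 : ℝ)) * ‖x‖ ^ (-(3 / 4 : ℝ)) := by
      have h1 : ∀ᶠ x in cocompact (EuclideanSpace ℝ (Fin 3)), 1 ≤ ‖x‖ :=
        (tendsto_norm_cocompact_atTop (E := EuclideanSpace ℝ (Fin 3))).eventually (eventually_ge_atTop 1)
      filter_upwards [h1] with x hx
      exact hbound x (norm_pos_iff.1 (by linarith))
    exact squeeze_zero' (Eventually.of_forall fun x => norm_nonneg _) hev hlim

/-! ### The representation of the derivatives of the pressure difference -/

section Twins

variable {V₁ V₂ : ℝ → EuclideanSpace ℝ (Fin 3) → EuclideanSpace ℝ (Fin 3)}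
  {Q₁ Q₂ : ℝ → EuclideanSpace ℝ (Fin 3) → ℝ}

/-- A decaying weight tends to zero at infinity: `C/(‖x‖+a)^{p+1} → 0` along `cocompact`. [folklore] -/
theorem tendsto_div_norm_add_pow_cocompact (C a : ℝ) (p : ℕ) :
    Tendsto (fun x : EuclideanSpace ℝ (Fin 3) => C / (‖x‖ + a) ^ (p + 1)) (cocompact (EuclideanSpace ℝ (Fin 3))) (𝓝 0) := by
  have h1 : Tendsto (fun x : EuclideanSpace ℝ (Fin 3) => (‖x‖ + a) ^ (p + 1)) (cocompact (EuclideanSpace ℝ (Fin 3))) atTop :=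
    (tendsto_pow_atTop (by omega)).comp (tendsto_atTop_add_const_right _ a
      (tendsto_norm_cocompact_atTop (E := EuclideanSpace ℝ (Fin 3))))
  have h2 := h1.inv_tendsto_atTop.const_mul C
  rw [mul_zero] at h2
  refine h2.congr fun x => ?_
  simp [div_eq_mul_inv]

/-- **The representation of all derivatives of the pressure difference.**  For two classical Navier–Stokes pairs on
the open backward slab with the scale-invariant packages and flatness of order `N + 2`, on every slice `t < 0`, for
every order `b`, every point `x` and all directions `m`,
`Dᵇ(Q₁(t) − Q₂(t))(x)(m) = −∫ Γ(x − y) Dᵇg(t,y)(m) dy`, where `g = div((w·∇)V₁ + (V₂·∇)w)`, `w = V₁(t) − V₂(t)` is the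
source of the pressure Poisson equation of the difference (both sides are `C²`, decay at infinity and have Laplacian
`−Dᵇg(·)(m)`; Liouville). [folklore] -/
theorem iteratedFDeriv_pressureDiff_apply_eq (hcl₁ : IsClassicalNSSolutionOn (Iio (0 : ℝ)) 1 0 V₁ Q₁)
    (hcl₂ : IsClassicalNSSolutionOn (Iio (0 : ℝ)) 1 0 V₂ Q₂) (hB₁ : ScaleInvariantBounds V₁ Q₁)
    (hB₂ : ScaleInvariantBounds V₂ Q₂) (N : ℕ) (hF : FarDecay (N + 2) V₁ V₂) (b : ℕ) {t : ℝ} (ht : t < 0)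
    (x : EuclideanSpace ℝ (Fin 3)) (m : Fin b → EuclideanSpace ℝ (Fin 3)) :
    iteratedFDeriv ℝ b (fun z => Q₁ t z - Q₂ t z) x m =
      -∫ y, newtonKernel (x - y) * iteratedFDeriv ℝ b (VectorCalculus.divergence fun y =>
          convect (fun z => V₁ t z - V₂ t z) (V₁ t) y + convect (V₂ t) (fun z => V₁ t z - V₂ t z) y) y m := by
  have hσ : 0 < Real.sqrt (-t) := Real.sqrt_pos.2 (by linarith)
  set a : ℝ := Real.sqrt (-t) with ha_def
  -- the pressure difference and the source on the slice
  set π : EuclideanSpace ℝ (Fin 3) → ℝ := fun z => Q₁ t z - Q₂ t z with hπ_def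
  set g : EuclideanSpace ℝ (Fin 3) → ℝ := VectorCalculus.divergence fun y =>
    convect (fun z => V₁ t z - V₂ t z) (V₁ t) y + convect (V₂ t) (fun z => V₁ t z - V₂ t z) y with hg_def
  have hπ : ContDiff ℝ ∞ π := (hcl₁.contDiff_pressure ht).sub (hcl₂.contDiff_pressure ht)
  have hg : ContDiff ℝ ∞ g := contDiff_divergence_of_smooth (contDiff_defectFlux_slice hcl₁ hcl₂ ht)
  have hΔπ : Δ π = -g := funext fun y => laplacian_pressureDiff_eq hcl₁ hcl₂ ht y
  -- the components
  set Lm : ((EuclideanSpace ℝ (Fin 3)) [×b]→L[ℝ] ℝ) →L[ℝ] ℝ :=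
    ContinuousMultilinearMap.apply ℝ (fun _ : Fin b => EuclideanSpace ℝ (Fin 3)) ℝ m with hLm
  set P : EuclideanSpace ℝ (Fin 3) → ℝ := fun x => iteratedFDeriv ℝ b π x m with hP_def
  set Gm : EuclideanSpace ℝ (Fin 3) → ℝ := fun x => iteratedFDeriv ℝ b g x m with hGm_def
  have eP : P = Lm ∘ iteratedFDeriv ℝ b π := by funext y; simp [hP_def, hLm]
  have eGm : Gm = Lm ∘ iteratedFDeriv ℝ b g := by funext y; simp [hGm_def, hLm]
  have hDπ : ContDiff ℝ ∞ (iteratedFDeriv ℝ b π) := hπ.iteratedFDeriv_right (m := ∞) le_rfl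
  have hDg : ContDiff ℝ ∞ (iteratedFDeriv ℝ b g) := hg.iteratedFDeriv_right (m := ∞) le_rfl
  have hP2 : ContDiff ℝ 2 P := by rw [eP]; exact Lm.contDiff.comp (hDπ.of_le (by norm_cast))
  have hGm2 : ContDiff ℝ 2 Gm := by rw [eGm]; exact Lm.contDiff.comp (hDg.of_le (by norm_cast))
  have hΔP : ∀ y, Δ P y = -Gm y := by
    intro y
    rw [eP, ContDiffAt.laplacian_CLM_comp_left (hDπ.of_le (by norm_cast)).contDiffAt, comp_apply,
      laplacian_iteratedFDeriv hπ b y, hΔπ, iteratedFDeriv_neg_apply]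
    simp [hLm, hGm_def]
  -- the decay of the component of the source
  have hprod : 0 ≤ ∏ i, ‖m i‖ := by positivity
  obtain ⟨C, hC0, hC⟩ := exists_pressureDiffSource_bound hcl₁ hcl₂ hB₁ hB₂ N hF b
  set A : ℝ := C * a⁻¹ * a ^ (N + 2) / a ^ (N + 2 + b) * ∏ i, ‖m i‖ with hA
  have hA0 : 0 ≤ A := by positivity
  have hGmb : ∀ y, |Gm y| ≤ A * ((‖y‖ + a) ^ 3)⁻¹ := by
    intro y
    have hρ : 0 < ‖y‖ + a := by positivity
    have h1 : |Gm y| ≤ ‖iteratedFDeriv ℝ b g y‖ * ∏ i, ‖m i‖ := by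
      rw [← Real.norm_eq_abs]; exact ContinuousMultilinearMap.le_opNorm _ _
    have h2 := hC t ht y
    have hpow : a ^ (N + 2 + b) * (‖y‖ + a) ^ 3 ≤ (‖y‖ + a) ^ (N + 5 + b) := by
      rw [show N + 5 + b = (N + 2 + b) + 3 by ring, pow_add (‖y‖ + a) (N + 2 + b) 3]
      exact mul_le_mul_of_nonneg_right (pow_le_pow_left₀ hσ.le (le_add_of_nonneg_left (norm_nonneg y)) (N + 2 + b))
        (pow_nonneg hρ.le 3)
    calc |Gm y| ≤ ‖iteratedFDeriv ℝ b g y‖ * ∏ i, ‖m i‖ := h1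
      _ ≤ C * a⁻¹ * a ^ (N + 2) / (‖y‖ + a) ^ (N + 5 + b) * ∏ i, ‖m i‖ :=
          mul_le_mul_of_nonneg_right h2 hprod
      _ ≤ C * a⁻¹ * a ^ (N + 2) / (a ^ (N + 2 + b) * (‖y‖ + a) ^ 3) * ∏ i, ‖m i‖ := by
          have hnum : 0 ≤ C * a⁻¹ * a ^ (N + 2) := by positivity
          have hden : 0 < a ^ (N + 2 + b) * (‖y‖ + a) ^ 3 := by positivity
          exact mul_le_mul_of_nonneg_right (div_le_div_of_nonneg_left hnum hden hpow) hprod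
      _ = A * ((‖y‖ + a) ^ 3)⁻¹ := by
          rw [hA]
          field_simp
  -- the Newtonian potential of the component of the source
  obtain ⟨hu2, hΔu, hu0⟩ := newtonPotential_scalar hGm2 hσ hA0 hGmb
  -- the decay of the component of the pressure difference
  obtain ⟨L, hL0, hL⟩ := exists_pressureDiff_bound hcl₁ hcl₂ hB₁ hB₂ b
  have hP0 : Tendsto P (cocompact (EuclideanSpace ℝ (Fin 3))) (𝓝 0) := by
    rw [tendsto_zero_iff_norm_tendsto_zero]
    refine squeeze_zero' (Eventually.of_forall fun y => norm_nonneg _) (Eventually.of_forall fun y => ?_)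
      (tendsto_div_norm_add_pow_cocompact (L * ∏ i, ‖m i‖) a (1 + b))
    calc ‖P y‖ ≤ ‖iteratedFDeriv ℝ b π y‖ * ∏ i, ‖m i‖ := ContinuousMultilinearMap.le_opNorm _ _
      _ ≤ L / (‖y‖ + a) ^ (2 + b) * ∏ i, ‖m i‖ := mul_le_mul_of_nonneg_right (hL b le_rfl t ht y) hprod
      _ = L * (∏ i, ‖m i‖) / (‖y‖ + a) ^ (1 + b + 1) := by rw [show 1 + b + 1 = 2 + b by ring]; ring
  -- Liouville for `P + u`
  set u : EuclideanSpace ℝ (Fin 3) → ℝ := fun y => ∫ z, newtonKernel (y - z) * Gm z with hu_def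
  have hΦ2 : ContDiff ℝ 2 (P + u) := hP2.add hu2
  have hΔΦ : ∀ y, Δ (P + u) y = 0 := fun y => by
    rw [(hP2.contDiffAt).laplacian_add hu2.contDiffAt, hΔP y, hΔu y, neg_add_cancel]
  have hharm : HarmonicOnNhd (P + u) univ := fun y _ => ⟨hΦ2.contDiffAt, Eventually.of_forall fun z => hΔΦ z⟩
  have hΦ0 : Tendsto (P + u) (cocompact (EuclideanSpace ℝ (Fin 3))) (𝓝 0) := by
    have h := hP0.add hu0
    rw [add_zero] at h
    exact h
  have hzero := congr_fun (harmonic_eq_zero_of_tendsto_cocompact hharm hΦ0) x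
  rw [Pi.add_apply, Pi.zero_apply] at hzero
  have : P x = -u x := by linarith
  simpa [hP_def, hGm_def, hu_def] using this

end Twins

/-! ### Registered sub-goal -/

/-- **Registered helper stub `stub_paintedLadderRepresentationTools`** of `stub_paintedLadderHigher` (crux
stmt-NavierStokesRegularity-11717, line `moment-conditioned-rellich`): `Δ(Dⁿφ) = Dⁿ(Δφ)` for smooth scalar maps, the
scalar Newtonian potential of an apex density (`C²`, Poisson, vanishing at infinity), and the representation
`Dᵇ(Q₁ − Q₂)(t,x)(m) = −∫ Γ(x − y) Dᵇg(t,y)(m) dy` of all derivatives of the pressure difference of two classical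
pairs with the packages and flatness of order `N + 2`. [folklore] -/
theorem stub_paintedLadderRepresentationTools :
    (∀ (φ : EuclideanSpace ℝ (Fin 3) → ℝ), ContDiff ℝ (⊤ : ℕ∞) φ → ∀ (n : ℕ) (x : EuclideanSpace ℝ (Fin 3)), Laplacian.laplacian (iteratedFDeriv ℝ n φ) x = iteratedFDeriv ℝ n (Laplacian.laplacian φ) x) ∧ (∀ (h : EuclideanSpace ℝ (Fin 3) → ℝ) (A a : ℝ), ContDiff ℝ 2 h → 0 < a → 0 ≤ A → (∀ y, |h y| ≤ A * ((‖y‖ + a) ^ 3)⁻¹) → ContDiff ℝ 2 (fun x => ∫ y, newtonKernel (x - y) * h y) ∧ (∀ x, Laplacian.laplacian (fun x => ∫ y, newtonKernel (x - y) * h y) x = h x) ∧ Tendsto (fun x => ∫ y, newtonKernel (x - y) * h y) (cocompact (EuclideanSpace ℝ (Fin 3))) (nhds 0)) ∧ (∀ (V₁ V₂ : ℝ → EuclideanSpace ℝ (Fin 3) → EuclideanSpace ℝ (Fin 3)) (Q₁ Q₂ : ℝ → EuclideanSpace ℝ (Fin 3) → ℝ), IsClassicalNSSolutionOn (Iio (0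 : ℝ)) 1 0 V₁ Q₁ → IsClassicalNSSolutionOn (Iio (0 : ℝ)) 1 0 V₂ Q₂ → ScaleInvariantBounds V₁ Q₁ → ScaleInvariantBounds V₂ Q₂ → ∀ N : ℕ, FarDecay (N + 2) V₁ V₂ → ∀ (b : ℕ) (t : ℝ), t < 0 → ∀ (x : EuclideanSpace ℝ (Fin 3)) (m : Fin b → EuclideanSpace ℝ (Fin 3)), iteratedFDeriv ℝ b (fun z => Q₁ t z - Q₂ t z) x m = -∫ y, newtonKernel (x - y) * iteratedFDeriv ℝ b (VectorCalculus.divergence fun y => convect (fun z => V₁ t z - V₂ t z) (V₁ t) y + convect (V₂ t) (fun z => V₁ t z - V₂ t z) y) y m) :=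
  ⟨fun _φ hφ n x => laplacian_iteratedFDeriv hφ n x,
    fun _h _A _a hh ha hA hb => newtonPotential_scalar hh ha hA hb,
    fun _V₁ _V₂ _Q₁ _Q₂ hcl₁ hcl₂ hB₁ hB₂ N hF b _t ht x m =>
      iteratedFDeriv_pressureDiff_apply_eq hcl₁ hcl₂ hB₁ hB₂ N hF b ht x m⟩

end Summit.NavierStokesRegularity.NavierStokesRegularity.Theorems.RellichScarScarRigidity

end
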